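import Literature.MathematicalPhysics.QuantumFieldTheory.Balaban1983to89.T4MatchingAssembly
import Literature.MathematicalPhysics.QuantumFieldTheory.Balaban1983to89.T4GoodClassBudget
import Literature.MathematicalPhysics.QuantumFieldTheory.Balaban1983to89.T4NestedShells

/-!
# T4MatchingClosure — node U5, the CLOSURE of the hybrid assembly: the owed obligations O-b1…O-b6 of the good-class
row at kernel level, the logarithmic cut in the weight half, the flattened shells in the shell slot, and the end-to-end
constructor of `T4MatchingAssembly.HybridNE7` from the named producers (cell `pub-balaban`, T4-DAG v6 §2 node U5, §5
rows T4-U5.E / E-a / E-b / E-c; journal row T4-U5.E-CLOSE*; typing + kernel bookkeeping only)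

HONEST FRAMING (T4-DAG PAGE 1).  The cell's T4 target is rung (B)+1: existence AND uniqueness of the `ε → 0` limit of
Bałaban's unit-scale averaged loop expectations on a FIXED finite torus — strictly beyond ultraviolet stability
([Balaban1988Convergent] Cor. 3 p. 264; [Balaban1989LargeFieldII] Thm 1 p. 355), NOT infinite volume, NOT a mass gap,
NOT the Clay problem.  NOTHING of the two-run comparison assembled here is PRINTED: every estimate below is a HYPOTHESIS
SHAPE (the cell's located new estimates NE7b, NE7c, NE7's good-class half, and the new cell NE-R1), consumed BY NAME from
the tree modules of the carved rows; everything proved is elementary real analysis over finite sums ([folklore]).  The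
manuscripts under audit are not cited for any disputed step.  Value = the typed closure of node U5's hybrid design with
every analytic input a visible binder + kernel bookkeeping; NOT summit progress.

WHAT IS CLOSED (the obligations the good-class row T4-U5.E-b left to the assembly seat, record `t4/T4-EST-U5E-b.md` §5,
and the open items of the assembly record `t4/T4-EST-U5.md` v1.1 §2).
* THE LITERAL BRIDGE (assembly record (ii)): `T4GoodClassBudget.GoodClause l₀ vol T (A − shA) (B − shB) Bad δ` IS the
  `core` field of `T4MatchingAssembly.HybridNE7` (definitional unfolding; `hybridNE7_of_goodClause_shell`,
  `goodClause_of_hybridNE7`), so `T4GoodClassBudget.TermBudget` on the cores gives `HybridNE7` with `δ = r + s`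
  (`hybridNE7_of_termBudget`); the GENERAL-δ plugs are used throughout — NOT `cauchySum_of_crossover_slotDom`, whose
  good-class remainder `crossoverDelta … 0` has no window / common-constant term (record §5, consumers).
* O-b5 / R3 — THE CUT IS LOGARITHMIC (interface I-1′ := "j⋆ = jlogOf C, C·(−log r) > 1" replacing I-1's linear
  `hfrac`): the weight half `RelWeightBound … (1 − exp(−S K))` from `T4HistoryPeeling.SlotDom` of both runs with the
  log-cut budgets `S K = V·r^{K − jlog(K)}` (`relWeightBound_of_slotDom_log`, summable by
  `T4GoodClassBudget.summable_weightMajorant_log`) or the two-rate form `S K = C_s·V·r^{K − jlog(K) + 1}/(1 − r)` of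
  `T4HistoryPeeling.slotBudget_le` (`summable_twoRateBudget_log`, `relWeightBound_of_slotDom_twoRate_log` —
  binder-for-binder `T4HistoryPeeling.relWeightBound_of_slotDom_twoRate` with `hc hfrac` replaced by `hC`); the cut
  constant exists (`exists_logCutConst`); the companion arithmetic `κ₀ ≥ 2⌈C log Λ⌉ + 8 ⇒ ⌈C log Λ⌉ + 3 ≤ κ₀/2 − 1`
  (`polyExponent_of_kappa`, `four_lt_kappa`, `summable_polyRate_of_kappa`).  §7 of `T4MatchingAssembly` (linear cut)
  stays valid and is not recommended (record §4 R3: the window count `Λ^{⌈σK⌉}` kills polynomially-small R-type terms).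
* THE SHELL SLOT = row T4-U5.E-c-SHELL°'s flattened nested shells (`T4NestedShells.shellWeightBound_of_flattened`:
  log-masses `L_K ≥ 0`, `Σ L_K < ∞`, shells `X − Xcore`, weight `1 − e^{−L_K}`), optionally PLUS the index-level class
  shell of `T4MatchingAssembly` §3 (finest-scale births of run B) by the union bound `T4NestedShells.shellWeightBound_add`
  (`shellWeightBound_flattened_add`) — the two shell species add, so the assembly record's question O-c5 vs O-c5′
  (G-pv02g6-3) is moot at kernel level; the weight condition `W + Wsh < 1` in BUDGET form `S_K + L_K (+ M_K) < 1`
  (`lt_one_of_budget₂`, `lt_one_of_budget₃`).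
* O-b1 / O-b3 / O-b4 — INTERFACE I-2′ AND THE NEW CELL NE-R1 AS BINDERS: `ReindexedBudget` — per good term the two-run
  constant splits as (RECENT part `CcRec`, deviating from a `t`-free class constant `c₀ K` by `≤ vol·s_K`: hazard H-U5b-1
  on the RECENT degrees of freedom only, O-b3; `c₀ : ℕ → ℝ` is `t`-free BY TYPE, O-b4) + (UV part: ONE number `ν K` per
  cutoff up to `vol·s₂ K`: NE-R1 (β), two-run half) and the radius as (recent `≤ vol·r_K`) + (UV response `vol·u_K`:
  NE-R1 (γ), two-run half); `termBudget_of_reindexed` shows NE-R1 enters node U5 ONLY through `ν` (free — absorbed in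
  the class constant) and two summable sequences `u`, `s₂`.  SCOPE OF NE-R1 AFTER THE REFEREE READING (record
  `t4/T4-REF-U5.md` v1 §2 F1/F3, row T4-U5.R; a reading, not a citable fact): the history-free resummation of a
  renormalised large-field structure into local analytic action terms with small coefficients is PRINTED PER STEP in ONE
  run (location only: [Balaban1989LargeFieldII] (1.90)–(1.92) p. 388, (1.97) p. 389, (1.98)–(1.102) p. 390,
  (1.103)–(1.104) p. 391), so I-2′ is print's
  own index set ((1.101)/(1.104): recent created regions + pending components); what is NOT PRINTED is the TWO-RUN
  comparison of the resummed factor — exactly the content of `uv_const` / `uv_radius` — and for the remnant families the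
  response is R-KIND (marginal terms, polynomial two-run response, no contraction gain): young clusters are rate-booked on
  the window, OLD-BORN clusters need the located input NE7b-rem (an AGE-RESOLVED remnant bound, NOT PRINTED; GAPS
  G-pv06g7-5) or, equivalently at index level, the ENLARGED bad class Bad′ of I-3 (components alive in the window born
  before `jlog(K) − A(K)·N′`; same carrier `Bad` of `SlotDom`, priced by the weight half).  Neither NE-R1's two-run
  half nor NE7b-rem is asserted or refuted here.  O-b2 (instantiating the recent part from the per-kind
  `T4RecentScale.FactorLogRatio` hypotheses with the §1 choice of centring) stays with the producers of rows T4-U5b.E /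
  T4-U5.E-c / T4-U3.B — this module consumes their OUTPUT shape `ReindexedBudget` / `TermBudget`.
* O-b6 — the owed one-liner: `Σ_K (K+1)·windowSum ρ Λ (jlog K) K < ∞` for every `0 < ρ < 1 ≤ Λ` (the E-type product
  term of record §3 S2), via the pointwise majorant `windowSum_log_le` (= the majorant inside the tree's
  `summable_windowSum_log`, exposed) and `T4CauchySum.summable_succ_pow_mul_geometric`: `summable_pow_mul_windowSum_log`
  (any polynomial weight), `summable_succ_mul_windowSum_log`.
* THE END-TO-END CONSTRUCTOR `hybridNE7_closure`: SlotDom ×2 (log cut) + flattened bounds ×2 + `S_K + L_K < 1` +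
  `ReindexedBudget` on the cores + `Summable r, u, s, s₂` ⇒ `HybridNE7 l₀ vol T A B Bad (1 − e^{−S}) (A − Acore)
  (B − Bcore) (1 − e^{−L}) (r + u + (s + s₂))`; then `T4MatchingAssembly.HybridNE7.cauchy` /
  `matchingModConstants_tail` apply verbatim, and `stringHybridNE7_intro` packages the datum with the scheme dictionary
  into `T4MatchingAssembly.StringHybridNE7`, the per-string hypothesis of `matchingModConstants_schemeZ` /
  `genFunCauchy_of_hybridNE7` / `hasContinuumLimit_of_hybridNE7` (node U0 targets).  §8: non-vacuity of
  `ReindexedBudget`.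
* §9 (v1.2) THE TAIL — THE WEIGHT CONDITION IS AUTOMATIC: both budgets are summable, hence tend to `0`, hence
  `S_K + L_K < 1` from some `K₀` on (`eventually_budget_lt_one`); all other hypotheses are stable under `K ↦ K₀ + K`
  (`slotDom_shift`, `reindexedBudget_shift`); `hybridNE7_closure_tail` = `hybridNE7_closure` WITHOUT `hlt`, concluding
  `∃ K₀, HybridNE7 …` for the shifted families; `stringHybridNE7_of_shift`, and `stringHybridNE7_closure` = per string,
  end to end: closure hypotheses without `hlt` + the E1/E2 dictionary from `K₀` ⇒ `∃ K₁, StringHybridNE7 S os l₀ vol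
  (K₀ + K₁)` — literally the per-string hypothesis of `hasContinuumLimit_of_hybridNE7`.

THE WINDOW INSTANTIATION, NAMED (referee obligation O-R2 / §2 F4 of `t4/T4-REF-U5.md`): LOG.  The closure below is
stated with `j⋆ = T4GoodClassBudget.jlogOf C`, `hC : 1 < C·(−log r₀)` (bad class `(K+1)^{−C(−log r₀)}`, p-series),
every rate-only kind and the R-type polynomial response closing by TRIVIAL counting on the log window (`κ₀ ≥ 2⌈C log Λ⌉ +
8`, `summable_polyRate_of_kappa`, `summable_succ_mul_windowSum_log`).  The LINEAR window of `T4MatchingAssembly` §7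
stays a correct, banked theorem; as THE instantiation it would additionally need a non-trivial count of recent
large-field structure (first moments, `T4GoodClassBudget.FirstMoment` / `capWeight_le` = an NE7b′ input, NOT PRINTED).
TWO CUTS are kept (referee O-R1): the WINDOW `jlog` books bad-class / rate-only MULTIPLICITY (this module); the
INTRINSIC LINEAR CROSSOVER books size-vs-rate of old small-field slices (`T4Crossover.crossoverDelta`, a `min` over all
scales, window-independent) inside the producers of `Summable r`.

WHERE EACH LOCATED NEW ESTIMATE ENTERS (all NOT PRINTED; binders only).  NE7b (row T4-U5.E-a, single-slot form; its
unprinted heart E2-en = a context-free pointwise insertion price, `T4InsertionProfile.PointDom → SlotDom`, unit pv14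
gen 6): `hDA`, `hDB`.  NE7b-rem (old-born remnant clusters, referee F2, GAPS G-pv06g7-5): EITHER the same `hDA`, `hDB`
with the enlarged class `Bad := Bad′` (index-level packaging; ONE engine with E2 — the slack-keeping re-run of the
inductive penalty bookkeeping) OR a size-booked summand of the recent radius `r` (age cut `A(K) = ⌈C′ log(K+1)⌉`,
summable iff `C′·(c_b p̄₀ − E) > 1`, the same p-series shape as `hC`).  NE7c (row T4-U5.E-c-SHELL°, flattened
log-masses): `hAhi`, `hBhi`, `hLs`.  NE7 good-class half (rows T4-U5.E-b / T4-U5.E-c: per-kind two-run rates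
NE2/NE2⁺/NE3/NE5/NE5′/NE5-B in sup form over the analyticity domains, INCLUDING the sub-locus NE2⁺-LF = two-run rates of
the large-field-localised Gaussian operators of the 𝐓′-operation (referee (0.3)(b), O-R4, owners U5b), recent deviations
H-U5b-1, young-remnant rates): the `recent_*` fields of `ReindexedBudget` and `Summable r, s`.  NE-R1, two-run half
(record `t4/T4-EST-U5E-b.md` §4 R1, re-scoped above): the `uv_*` fields and `Summable u, s₂`.  Node U4′ / U2
(scale-shift rate `θ < 1`): inside the producers' proofs of `Summable r` (`T4Crossover.summable_crossoverDelta`,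
`T4GoodClassBudget.summable_windowSum_log`, `summable_polyRate_of_kappa`, `summable_succ_mul_windowSum_log`).  If any of
them fails the module proves nothing, as it should.

Sources.  [King1986] (3.10)–(3.13) pp. 656–657 — printed TEMPLATE of the hybrid split, context only (quoted in the
tree's `T4HybridMatching`); [Balaban1988Convergent] p. 264, [Balaban1989LargeFieldII] p. 355 — LOCATION of the printed
one-run theorems only; [Balaban1989LargeFieldII] pp. 378–379, 388, 390–391 — LOCATION of the one-run renormalisation /
resummation structure behind I-2′ (referee record `t4/T4-REF-U5.md` §1 L1–L7; nothing of it is used as a hypothesis).  No disputed step of a manuscript under audit is used; no programme-internal claim is cited.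
Unit `b2b-balaban-pv02` gen 7 (journal CLAIM T4-U5.E-CLOSE* 2026-08-19T00:10:51Z; v1 p181527, v1.1 p181542 = DOCFIX answering referee
obligation O-R2 of `t4/T4-REF-U5.md` v1 — kernel content unchanged; v1.2 p181613 = append-only §9, journal row
T4-U5.E-CLOSE*-TAIL; v1.3 = DOCFIX-lite after XREADs C-t4l-17 (L1: guillemets reserved for verbatim print, L2: locator
of (1.97)–(1.104)) and C-pv14-41 (R2: node-U0 structural inputs named in §9) — kernel content unchanged); records `t4/T4-EST-U5.md` v1.2,
`t4/T4-EST-U5E-b.md` (row E-b, unit pv16), `t4/T4-EST-U5Ec-shells.md` (row E-c-SHELL°, unit b01),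
`t4/T4-EST-U5Ea.md` / `T4-EST-U5Ea2.md` (row E-a, unit pv14).
-/

open Finset _root_.Filter _root_.Topology

namespace Literature.MathematicalPhysics.QuantumFieldTheory.Balaban1983to89.T4MatchingClosure

open T4HybridMatching T4CauchySum T4WeightBudget T4IndicatorShell T4MatchingAssembly T4GoodClassBudget
  T4HistoryPeeling

/-! ## §1 The literal bridge: the good-class row's output IS the `core` field -/

section Bridge

variable {ι : Type*} [DecidableEq ι] {l₀ vol : ℝ} {T : ℕ → Finset ι} {A B shA shB Acore Bcore : ℕ → ℝ → ι → ℝ}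
  {Bad : ℕ → ℝ → Finset ι} {W Wsh δ : ℕ → ℝ} {Cc Rr : ℕ → ℝ → ι → ℝ} {c₀ r s : ℕ → ℝ}

/-- **THE BRIDGE (row T4-U5.E-b ⇒ node U5)**: NE7b in output shape, NE7c, `W + Wsh < 1`, `Summable δ` and the good
clause `T4GoodClassBudget.GoodClause` FOR THE CORES `A − shA`, `B − shB` ⇒ `HybridNE7` — the clause is the `core` field
up to unfolding the definition. [folklore] -/
theorem hybridNE7_of_goodClause_shell (hW : RelWeightBound l₀ T A B Bad W)
    (hSh : ShellWeightBound l₀ T A B shA shB Wsh) (hlt : ∀ K, W K + Wsh K < 1) (hδ : Summable δ)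
    (hcore : GoodClause l₀ vol T (fun K t τ => A K t τ - shA K t τ) (fun K t τ => B K t τ - shB K t τ) Bad δ) :
    HybridNE7 l₀ vol T A B Bad W shA shB Wsh δ :=
  hybridNE7_of_relWeightBound hW hSh hlt hδ hcore

/-- … and conversely the `core` field of a `HybridNE7` datum IS the good clause for the cores (faithfulness of the
bridge: nothing is lost or added). [folklore] -/
theorem goodClause_of_hybridNE7 (h : HybridNE7 l₀ vol T A B Bad W shA shB Wsh δ) :
    GoodClause l₀ vol T (fun K t τ => A K t τ - shA K t τ) (fun K t τ => B K t τ - shB K t τ) Bad δ :=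
  h.core

/-- **Row T4-U5.E-b's per-term budget on the cores ⇒ `HybridNE7` with `δ = r + s`** (`goodClause_of_termBudget`).
[folklore] -/
theorem hybridNE7_of_termBudget (hW : RelWeightBound l₀ T A B Bad W) (hSh : ShellWeightBound l₀ T A B shA shB Wsh)
    (hlt : ∀ K, W K + Wsh K < 1) (hr : Summable r) (hs : Summable s)
    (h : TermBudget l₀ vol T (fun K t τ => A K t τ - shA K t τ) (fun K t τ => B K t τ - shB K t τ) Bad Cc Rr c₀ r s) :
    HybridNE7 l₀ vol T A B Bad W shA shB Wsh (fun K => r K + s K) :=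
  hybridNE7_of_goodClause_shell hW hSh hlt (hr.add hs) (goodClause_of_termBudget h)

/-- With shells presented as `X − Xcore` (row T4-U5.E-c-SHELL°) the good clause for the hybrid cores `X − (X − Xcore)`
is the good clause for `Acore`, `Bcore` themselves (`T4NestedShells.hcore_of_cores`). [folklore] -/
theorem goodClause_of_cores (h : GoodClause l₀ vol T Acore Bcore Bad δ) :
    GoodClause l₀ vol T (fun K t τ => A K t τ - (A K t τ - Acore K t τ)) (fun K t τ => B K t τ - (B K t τ - Bcore K t τ))
      Bad δ :=
  T4NestedShells.hcore_of_cores h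

/-- The shell-free bridge: NE7b in output shape + the PLAIN good clause ⇒ `HybridNE7` with zero shells
(`T4MatchingAssembly.hybridNE7_noShell`). [folklore] -/
theorem hybridNE7_of_goodClause (hW : RelWeightBound l₀ T A B Bad W)
    (hA : ∀ K t, |t| ≤ l₀ → ∀ τ ∈ T K, 0 ≤ A K t τ) (hB : ∀ K t, |t| ≤ l₀ → ∀ τ ∈ T K, 0 ≤ B K t τ)
    (hδ : Summable δ) (hgood : GoodClause l₀ vol T A B Bad δ) :
    HybridNE7 l₀ vol T A B Bad W (fun _ _ _ => 0) (fun _ _ _ => 0) (fun _ => 0) δ :=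
  hybridNE7_noShell hW hA hB hδ hgood

end Bridge

/-! ## §2 The weight half under the LOGARITHMIC cut (interface I-1′; record `t4/T4-EST-U5E-b.md` §4 R3, O-b5) -/

section LogCut

variable {ι : Type*} [DecidableEq ι] {l₀ : ℝ} {T : ℕ → Finset ι} {A B : ℕ → ℝ → ι → ℝ} {Bad : ℕ → ℝ → Finset ι}
  {S S' : ℕ → ℝ}

/-- `SlotDom` is MONOTONE in the slot budget (only `Σ_i x i ≤ S K` mentions it). [folklore] -/
theorem slotDom_mono (h : SlotDom l₀ T A Bad S) (hSS : ∀ K, S K ≤ S' K) : SlotDom l₀ T A Bad S' where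
  dom K t ht := by
    obtain ⟨n, Φ, x, hx, hxS, hBad, h1⟩ := h.dom K t ht
    exact ⟨n, Φ, x, hx, hxS.trans (hSS K), hBad, h1⟩

/-- The log-cut budget `V·r^{K − jlog(K)}` is non-negative. [folklore] -/
theorem logBudget_nonneg {r V : ℝ} (C : ℝ) (h0 : 0 ≤ r) (hV : 0 ≤ V) (K : ℕ) : 0 ≤ V * r ^ (K - jlogOf C K) :=
  mul_nonneg hV (pow_nonneg h0 _)

/-- A cut constant with `C·(−log r) > 1` EXISTS for every `0 < r < 1` (e.g. `C = 2/(−log r)`): O-b5 (a) is a choice,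
not a condition. [folklore] -/
theorem exists_logCutConst {r : ℝ} (h0 : 0 < r) (h1 : r < 1) : ∃ C : ℝ, 0 ≤ C ∧ 1 < C * (-Real.log r) := by
  have hl : 0 < -Real.log r := by
    have := Real.log_neg h0 h1
    linarith
  refine ⟨2 / (-Real.log r), div_nonneg zero_le_two hl.le, ?_⟩
  rw [div_mul_cancel₀ _ hl.ne']
  norm_num

/-- **NE7b UNDER THE LOG CUT, SIMPLE BUDGET**: `SlotDom` for both runs with `S K = V·r^{K − jlog_C(K)}`, `0 < r < 1`,
`V ≥ 0`, `C·(−log r) > 1`, non-negative terms ⇒ `RelWeightBound … (1 − exp(−S K))` — `relWeightBound_of_slotDom`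
with `Summable S` from `T4GoodClassBudget.summable_weightMajorant_log` (p-series + geometric series; NO positive
fraction of old scales is needed). [folklore] -/
theorem relWeightBound_of_slotDom_log {r V C : ℝ} (h0 : 0 < r) (h1 : r < 1) (hV : 0 ≤ V)
    (hC : 1 < C * (-Real.log r))
    (hA : ∀ K t, |t| ≤ l₀ → ∀ τ ∈ T K, 0 ≤ A K t τ) (hB : ∀ K t, |t| ≤ l₀ → ∀ τ ∈ T K, 0 ≤ B K t τ)
    (hDA : SlotDom l₀ T A Bad fun K => V * r ^ (K - jlogOf C K))
    (hDB : SlotDom l₀ T B Bad fun K => V * r ^ (K - jlogOf C K)) :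
    RelWeightBound l₀ T A B Bad fun K => 1 - Real.exp (-(V * r ^ (K - jlogOf C K))) :=
  relWeightBound_of_slotDom (fun K => logBudget_nonneg C h0.le hV K) (summable_weightMajorant_log h0 h1 hV hC) hA hB
    hDA hDB

/-- The TWO-RATE budget of `T4HistoryPeeling.slotBudget_le` with the LOG cut, `C_s·V·r^{K − jlog(K) + 1}/(1 − r)`, is
summable under `C·(−log r) > 1` (compare `T4HistoryPeeling.summable_twoRateBudget`, which needs `c·K ≤ K − j⋆(K)`).
[folklore] -/
theorem summable_twoRateBudget_log {Cs V r C : ℝ} (hCs : 0 ≤ Cs) (hV : 0 ≤ V) (h0 : 0 < r) (h1 : r < 1)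
    (hC : 1 < C * (-Real.log r)) :
    Summable fun K => Cs * V * (r ^ (K - jlogOf C K + 1) / (1 - r)) := by
  have h := summable_weightMajorant_log (V := Cs * V * r / (1 - r)) (C := C) h0 h1
    (div_nonneg (mul_nonneg (mul_nonneg hCs hV) h0.le) (by linarith)) hC
  refine h.congr fun K => ?_
  rw [pow_succ]
  ring

/-- **NE7b UNDER THE LOG CUT, TWO-RATE BUDGET** — binder-for-binder `T4HistoryPeeling.relWeightBound_of_slotDom_twoRate`
with the interface condition I-1 (`hc`, `hfrac`) replaced by I-1′ (`hC : 1 < C·(−log r)`, `jstar := jlogOf C`).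
[folklore] -/
theorem relWeightBound_of_slotDom_twoRate_log {Cs V r C : ℝ} (hCs : 0 ≤ Cs) (hV : 0 ≤ V) (h0 : 0 < r)
    (h1 : r < 1) (hC : 1 < C * (-Real.log r))
    (hA : ∀ K t, |t| ≤ l₀ → ∀ τ ∈ T K, 0 ≤ A K t τ) (hB : ∀ K t, |t| ≤ l₀ → ∀ τ ∈ T K, 0 ≤ B K t τ)
    (hDA : SlotDom l₀ T A Bad fun K => Cs * V * (r ^ (K - jlogOf C K + 1) / (1 - r)))
    (hDB : SlotDom l₀ T B Bad fun K => Cs * V * (r ^ (K - jlogOf C K + 1) / (1 - r))) :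
    RelWeightBound l₀ T A B Bad fun K => 1 - Real.exp (-(Cs * V * (r ^ (K - jlogOf C K + 1) / (1 - r)))) :=
  relWeightBound_of_slotDom (twoRateBudget_nonneg hCs hV h0.le h1 (jlogOf C))
    (summable_twoRateBudget_log hCs hV h0 h1 hC) hA hB hDA hDB

end LogCut

/-! ## §3 The shell slot: the weight condition in budget form; flattened shells plus the class shell -/

section Shell

/-- THE WEIGHT CONDITION IN BUDGET FORM, two species: `S + L < 1 ⇒ (1 − e^{−S}) + (1 − e^{−L}) < 1` (bad class of slot
budget `S`, flattened shells of log-mass `L`; `1 − e^{−x} ≤ x` is `Real.add_one_le_exp`). [folklore] -/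
theorem lt_one_of_budget₂ {S L : ℝ} (h : S + L < 1) : (1 - Real.exp (-S)) + (1 - Real.exp (-L)) < 1 := by
  linarith [Real.add_one_le_exp (-S), Real.add_one_le_exp (-L)]

/-- … three species: `W₂ ≤ M`, `S + L + M < 1 ⇒ (1 − e^{−S}) + ((1 − e^{−L}) + W₂) < 1` (plus a second shell bound of
weight `W₂`, e.g. the class shell of `T4MatchingAssembly.shellWeightBound_of_fibres`). [folklore] -/
theorem lt_one_of_budget₃ {S L M W₂ : ℝ} (hW : W₂ ≤ M) (h : S + L + M < 1) :
    (1 - Real.exp (-S)) + ((1 - Real.exp (-L)) + W₂) < 1 := by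
  linarith [Real.add_one_le_exp (-S), Real.add_one_le_exp (-L)]

variable {ι : Type*} {l₀ : ℝ} {T : ℕ → Finset ι} {A B Acore Bcore shA₂ shB₂ shA shB : ℕ → ℝ → ι → ℝ}
  {L Wsh₂ : ℕ → ℝ}

/-- **TWO SHELL SPECIES ADD**: the flattened nested shells `X − Xcore` of log-mass `L` (row T4-U5.E-c-SHELL°,
`T4NestedShells.shellWeightBound_of_flattened`) and any second single-run shell bound `(shA₂, shB₂, Wsh₂)` (e.g. the
index-level class shell of node U5d, `T4MatchingAssembly.shellWeightBound_of_fibres`), with total shell parts obeying the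
union bound ⇒ ONE `ShellWeightBound` of weight `(1 − e^{−L}) + Wsh₂` (`T4NestedShells.shellWeightBound_add`).  Hence the
assembly record's alternative O-c5 / O-c5′ is moot: either presentation of run B's finest-scale births adds into the
shell slot. [folklore] -/
theorem shellWeightBound_flattened_add (hL0 : ∀ K, 0 ≤ L K) (hLs : Summable L)
    (hA0 : ∀ K t, |t| ≤ l₀ → ∀ τ ∈ T K, 0 ≤ Acore K t τ)
    (hAlo : ∀ K t, |t| ≤ l₀ → ∀ τ ∈ T K, Acore K t τ ≤ A K t τ)
    (hAhi : ∀ K t, |t| ≤ l₀ → ∀ τ ∈ T K, A K t τ ≤ Real.exp (L K) * Acore K t τ)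
    (hB0 : ∀ K t, |t| ≤ l₀ → ∀ τ ∈ T K, 0 ≤ Bcore K t τ)
    (hBlo : ∀ K t, |t| ≤ l₀ → ∀ τ ∈ T K, Bcore K t τ ≤ B K t τ)
    (hBhi : ∀ K t, |t| ≤ l₀ → ∀ τ ∈ T K, B K t τ ≤ Real.exp (L K) * Bcore K t τ)
    (h₂ : ShellWeightBound l₀ T A B shA₂ shB₂ Wsh₂)
    (hsA0 : ∀ K t, |t| ≤ l₀ → ∀ τ ∈ T K, 0 ≤ shA K t τ) (hsAle : ∀ K t, |t| ≤ l₀ → ∀ τ ∈ T K, shA K t τ ≤ A K t τ)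
    (hsAu : ∀ K t, |t| ≤ l₀ → ∀ τ ∈ T K, shA K t τ ≤ (A K t τ - Acore K t τ) + shA₂ K t τ)
    (hsB0 : ∀ K t, |t| ≤ l₀ → ∀ τ ∈ T K, 0 ≤ shB K t τ) (hsBle : ∀ K t, |t| ≤ l₀ → ∀ τ ∈ T K, shB K t τ ≤ B K t τ)
    (hsBu : ∀ K t, |t| ≤ l₀ → ∀ τ ∈ T K, shB K t τ ≤ (B K t τ - Bcore K t τ) + shB₂ K t τ) :
    ShellWeightBound l₀ T A B shA shB fun K => (1 - Real.exp (-L K)) + Wsh₂ K :=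
  T4NestedShells.shellWeightBound_add (T4NestedShells.shellWeightBound_of_flattened hL0 hLs hA0 hAlo hAhi hB0 hBlo hBhi)
    h₂ hsA0 hsAle hsAu hsB0 hsBle hsBu

end Shell

/-! ## §4 Interface I-2′ and the new cell NE-R1 as binders: the re-indexed per-term budget (O-b1, O-b3, O-b4) -/

section Reindexed

variable {ι : Type*} [DecidableEq ι] {l₀ vol : ℝ} {T : ℕ → Finset ι} {A B : ℕ → ℝ → ι → ℝ} {Bad : ℕ → ℝ → Finset ι}
  {Cc Rr CcRec RrRec : ℕ → ℝ → ι → ℝ} {ν u s₂ c₀ r s : ℕ → ℝ}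

/-- HYPOTHESIS SHAPE `ReindexedBudget` — THE PER-TERM BUDGET OF NODE U5 UNDER INTERFACE I-2′ WITH THE NEW CELL NE-R1
NAMED (NOT PRINTED; nothing asserted).  Terms are indexed by their RECENT history (scales `≥ jlog(K)`) and their old
PENDING data (I-3: pending ⇒ bad); the sums over old RENORMALISED large-field patterns are performed INSIDE the term
value (record `t4/T4-EST-U5E-b.md` §4 R1 (v)).  Per good term `τ` at `(K, t)`, `|t| ≤ l₀`: the two-run sandwich
`e^{Cc − Rr}·A ≤ B ≤ e^{Cc + Rr}·A` (`T4RecentScale.goodTerm_sandwich`, all factors), whose constant and radius SPLIT as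
* `uv_const` — NE-R1 (β), TWO-RUN HALF: the log-ratio of the RESUMMED UV factor (print resums a renormalised structure
  per step in one run — referee record `t4/T4-REF-U5.md` F1; the two-run comparison is NOT PRINTED) has constant part
  ONE NUMBER `ν K` per cutoff, common to all good terms up to recent-dof deviations `vol·s₂ K`:
  `|Cc − (CcRec + ν K)| ≤ vol·s₂ K`;
* `uv_radius` — NE-R1 (γ), TWO-RUN HALF: its field- and term-dependent part per unit volume, `vol·u K`:
  `Rr ≤ RrRec + vol·u K` (for the remnant families R-KIND — marginal terms, polynomial two-run response, referee F3;
  old-born clusters through NE7b-rem or the enlarged class Bad′, see the module docstring);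
* `recent_remainder` — rows T4-U5.E-b S2 / T4-U5.E-c: the recent factors' radii `RrRec ≤ vol·r K` (crossover, window
  sums, boundary group, R-type polynomial term);
* `recent_deviation` — hazard H-U5b-1 ON THE RECENT DEGREES OF FREEDOM ONLY (O-b3) with a class constant `c₀ K` that
  is `t`-FREE BY ITS TYPE `ℕ → ℝ` (H-U5b-1′, O-b4: "`t` enters only the unit-scale insertion"): `|CcRec − c₀ K| ≤ vol·s K`.
Instantiating the `recent_*` fields from the per-kind `T4RecentScale.FactorLogRatio` hypotheses with the choice of
centring of `T4GoodClassBudget` §1 is O-b2 and belongs to the producers; this module consumes the shape. [folklore] -/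
structure ReindexedBudget {ι : Type*} [DecidableEq ι] (l₀ vol : ℝ) (T : ℕ → Finset ι) (A B : ℕ → ℝ → ι → ℝ)
    (Bad : ℕ → ℝ → Finset ι) (Cc Rr CcRec RrRec : ℕ → ℝ → ι → ℝ) (ν u s₂ c₀ r s : ℕ → ℝ) : Prop where
  /-- good terms of run A are non-negative (I-2) -/
  nonneg : ∀ K t, |t| ≤ l₀ → ∀ τ ∈ T K \ Bad K t, 0 ≤ A K t τ
  /-- lower half of the per-term sandwich -/
  lower : ∀ K t, |t| ≤ l₀ → ∀ τ ∈ T K \ Bad K t, Real.exp (Cc K t τ - Rr K t τ) * A K t τ ≤ B K t τ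
  /-- upper half of the per-term sandwich -/
  upper : ∀ K t, |t| ≤ l₀ → ∀ τ ∈ T K \ Bad K t, B K t τ ≤ Real.exp (Cc K t τ + Rr K t τ) * A K t τ
  /-- NE-R1 (β): the UV constant is one number `ν K` per cutoff, up to recent-dof deviations `vol·s₂ K` -/
  uv_const : ∀ K t, |t| ≤ l₀ → ∀ τ ∈ T K \ Bad K t, |Cc K t τ - (CcRec K t τ + ν K)| ≤ vol * s₂ K
  /-- NE-R1 (γ): the UV radius per unit volume -/
  uv_radius : ∀ K t, |t| ≤ l₀ → ∀ τ ∈ T K \ Bad K t, Rr K t τ ≤ RrRec K t τ + vol * u K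
  /-- the recent factors' radius per unit volume (rows T4-U5.E-b / E-c) -/
  recent_remainder : ∀ K t, |t| ≤ l₀ → ∀ τ ∈ T K \ Bad K t, RrRec K t τ ≤ vol * r K
  /-- H-U5b-1 on recent dof with a `t`-free class constant (O-b3, O-b4) -/
  recent_deviation : ∀ K t, |t| ≤ l₀ → ∀ τ ∈ T K \ Bad K t, |CcRec K t τ - c₀ K| ≤ vol * s K

/-- **NE-R1 ENTERS NODE U5 ONLY THROUGH `ν` (free), `u` AND `s₂`**: a re-indexed budget is a
`T4GoodClassBudget.TermBudget` with class constant `c₀ K + ν K`, remainder rate `r K + u K` and deviation rate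
`s K + s₂ K`. [folklore] -/
theorem termBudget_of_reindexed (h : ReindexedBudget l₀ vol T A B Bad Cc Rr CcRec RrRec ν u s₂ c₀ r s) :
    TermBudget l₀ vol T A B Bad Cc Rr (fun K => c₀ K + ν K) (fun K => r K + u K) (fun K => s K + s₂ K) where
  nonneg := h.nonneg
  lower := h.lower
  upper := h.upper
  remainder K t ht τ hτ := by
    have h1 := h.uv_radius K t ht τ hτ
    have h2 := h.recent_remainder K t ht τ hτ
    rw [mul_add]
    linarith
  deviation K t ht τ hτ := by
    have h1 := abs_le.mp (h.uv_const K t ht τ hτ)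
    have h2 := abs_le.mp (h.recent_deviation K t ht τ hτ)
    rw [mul_add, abs_le]
    constructor <;> linarith [h1.1, h1.2, h2.1, h2.2]

/-- … hence the good clause with `δ = (r + u) + (s + s₂)`. [folklore] -/
theorem goodClause_of_reindexed (h : ReindexedBudget l₀ vol T A B Bad Cc Rr CcRec RrRec ν u s₂ c₀ r s) :
    GoodClause l₀ vol T A B Bad fun K => (r K + u K) + (s K + s₂ K) :=
  goodClause_of_termBudget (termBudget_of_reindexed h)

/-- The remainder rate `(r + u) + (s + s₂)` of the re-indexed budget is summable from its four named summable pieces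
(node U4′ through the producers; NE-R1 contributes `u`, `s₂`). [folklore] -/
theorem summable_reindexedDelta (hr : Summable r) (hu : Summable u) (hs : Summable s) (hs₂ : Summable s₂) :
    Summable fun K => (r K + u K) + (s K + s₂ K) :=
  (hr.add hu).add (hs.add hs₂)

end Reindexed

/-! ## §5 The owed summabilities on the log window (O-b6) and the `κ₀` arithmetic (O-b5) -/

section Budget

/-- THE POINTWISE MAJORANT OF THE LOG-WINDOW θ-SUM (the bound inside the tree's `summable_windowSum_log`, exposed):
`windowSum θ Λ (jlog K) K ≤ (C+2)·θ⁻¹Λ·(K+1)^{⌈C log θ⁻¹ + C log Λ⌉ + 1}·θ^K` for `0 < θ < 1 ≤ Λ`, `C ≥ 0`. [folklore] -/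
theorem windowSum_log_le {θ Λ C : ℝ} (hθ : 0 < θ) (hθ1 : θ < 1) (hΛ : 1 ≤ Λ) (hC : 0 ≤ C) (K : ℕ) :
    windowSum θ Λ (jlogOf C K) K ≤
      (C + 2) * (θ⁻¹ * Λ) * (((K : ℝ) + 1) ^ (⌈C * Real.log θ⁻¹ + C * Real.log Λ⌉₊ + 1) * θ ^ K) := by
  have hΛ0 : 0 < Λ := lt_of_lt_of_le one_pos hΛ
  have hK0 : (0 : ℝ) ≤ (K : ℝ) := Nat.cast_nonneg K
  have hK1 : (1 : ℝ) ≤ (K : ℝ) + 1 := by linarith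
  have hKp : (0 : ℝ) < (K : ℝ) + 1 := by positivity
  have hlen : (((K - jlogOf C K : ℕ) : ℝ) + 1) ≤ (C + 2) * ((K : ℝ) + 1) := by
    have h1 := sub_jlogOf_le hC K
    have hlog : Real.log ((K : ℝ) + 1) ≤ (K : ℝ) + 1 - 1 := Real.log_le_sub_one_of_pos hKp
    have h2 : C * Real.log ((K : ℝ) + 1) ≤ C * K := by
      have := mul_le_mul_of_nonneg_left hlog hC; linarith
    have e : (C + 2) * ((K : ℝ) + 1) = C * K + C + 2 * K + 2 := by ring
    rw [e]; linarith
  have hprod : ((K : ℝ) + 1) ^ (C * Real.log θ⁻¹) * ((K : ℝ) + 1) ^ (C * Real.log Λ) ≤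
      ((K : ℝ) + 1) ^ (⌈C * Real.log θ⁻¹ + C * Real.log Λ⌉₊) := by
    rw [← Real.rpow_add hKp]
    calc ((K : ℝ) + 1) ^ (C * Real.log θ⁻¹ + C * Real.log Λ)
        ≤ ((K : ℝ) + 1) ^ ((⌈C * Real.log θ⁻¹ + C * Real.log Λ⌉₊ : ℕ) : ℝ) :=
          Real.rpow_le_rpow_of_exponent_le hK1 (Nat.le_ceil _)
      _ = ((K : ℝ) + 1) ^ (⌈C * Real.log θ⁻¹ + C * Real.log Λ⌉₊) := Real.rpow_natCast _ _
  have hθK : 0 ≤ θ ^ K := pow_nonneg hθ.le K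
  have hA0 : 0 ≤ (C + 2) * (θ⁻¹ * Λ) := by positivity
  calc windowSum θ Λ (jlogOf C K) K
      ≤ (((K - jlogOf C K : ℕ) : ℝ) + 1) * (θ ^ jlogOf C K * Λ ^ (K - jlogOf C K)) :=
        windowSum_le_length hθ.le hθ1.le hΛ (jlogOf_le C K)
    _ ≤ ((C + 2) * ((K : ℝ) + 1)) *
          ((θ ^ K * (θ⁻¹ * ((K : ℝ) + 1) ^ (C * Real.log θ⁻¹))) * (Λ * ((K : ℝ) + 1) ^ (C * Real.log Λ))) :=
        mul_le_mul hlen (mul_le_mul (pow_logCut_le hθ hθ1.le hC K) (pow_logWindow_le hΛ hC K)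
          (by positivity) (by positivity)) (by positivity) (by positivity)
    _ = (C + 2) * (θ⁻¹ * Λ) *
          (((K : ℝ) + 1) * (((K : ℝ) + 1) ^ (C * Real.log θ⁻¹) * ((K : ℝ) + 1) ^ (C * Real.log Λ)) * θ ^ K) := by
        ring
    _ ≤ (C + 2) * (θ⁻¹ * Λ) * (((K : ℝ) + 1) * ((K : ℝ) + 1) ^ (⌈C * Real.log θ⁻¹ + C * Real.log Λ⌉₊) * θ ^ K) :=
        mul_le_mul_of_nonneg_left (mul_le_mul_of_nonneg_right (mul_le_mul_of_nonneg_left hprod hKp.le) hθK) hA0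
    _ = (C + 2) * (θ⁻¹ * Λ) * (((K : ℝ) + 1) ^ (⌈C * Real.log θ⁻¹ + C * Real.log Λ⌉₊ + 1) * θ ^ K) := by ring

/-- **ANY POLYNOMIAL WEIGHT ON THE LOG WINDOW IS SUMMABLE**: `Σ_K (K+1)^p·windowSum θ Λ (jlog K) K < ∞` for every
`0 < θ < 1 ≤ Λ`, `C ≥ 0`, `p : ℕ` (`windowSum_log_le` + `T4CauchySum.summable_succ_pow_mul_geometric`). [folklore] -/
theorem summable_pow_mul_windowSum_log {θ Λ C : ℝ} (hθ : 0 < θ) (hθ1 : θ < 1) (hΛ : 1 ≤ Λ) (hC : 0 ≤ C) (p : ℕ) :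
    Summable fun K : ℕ => ((K : ℝ) + 1) ^ p * windowSum θ Λ (jlogOf C K) K := by
  have hΛ0 : 0 < Λ := lt_of_lt_of_le one_pos hΛ
  have hmaj : Summable (fun K : ℕ => (C + 2) * (θ⁻¹ * Λ) *
      (((K : ℝ) + 1) ^ (p + (⌈C * Real.log θ⁻¹ + C * Real.log Λ⌉₊ + 1)) * θ ^ K)) :=
    (summable_succ_pow_mul_geometric hθ.le hθ1 _).mul_left _
  refine Summable.of_nonneg_of_le (fun K => mul_nonneg (by positivity) (windowSum_nonneg hθ.le hΛ0.le _ _))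
    (fun K => ?_) hmaj
  calc ((K : ℝ) + 1) ^ p * windowSum θ Λ (jlogOf C K) K
      ≤ ((K : ℝ) + 1) ^ p * ((C + 2) * (θ⁻¹ * Λ) *
          (((K : ℝ) + 1) ^ (⌈C * Real.log θ⁻¹ + C * Real.log Λ⌉₊ + 1) * θ ^ K)) :=
        mul_le_mul_of_nonneg_left (windowSum_log_le hθ hθ1 hΛ hC K) (by positivity)
    _ = (C + 2) * (θ⁻¹ * Λ) *
          (((K : ℝ) + 1) ^ (p + (⌈C * Real.log θ⁻¹ + C * Real.log Λ⌉₊ + 1)) * θ ^ K) := by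
        ring

/-- **O-b6, THE OWED ONE-LINER**: `Σ_K (K+1)·windowSum ρ Λ (jlog K) K < ∞` for every `0 < ρ < 1 ≤ Λ` (the E-type
product term of record `t4/T4-EST-U5E-b.md` §3 S2, `ρ = max(θ, a)`: `(K+1)·ρ`-window from
`T4GoodClassBudget.sum_pow_mul_pow_le` / `sum_slice_le_of_rateSize`). [folklore] -/
theorem summable_succ_mul_windowSum_log {ρ Λ C : ℝ} (hρ : 0 < ρ) (hρ1 : ρ < 1) (hΛ : 1 ≤ Λ) (hC : 0 ≤ C) :
    Summable fun K : ℕ => ((K : ℝ) + 1) * windowSum ρ Λ (jlogOf C K) K := by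
  simpa only [pow_one] using summable_pow_mul_windowSum_log hρ hρ1 hΛ hC 1

/-- O-b5 (b), THE `κ₀` ARITHMETIC: `κ₀ ≥ 2⌈C log Λ⌉ + 8 ⇒ ⌈C log Λ⌉ + 3 ≤ κ₀/2 − 1` (the exponent `q = κ₀/2 − 1` of the
R-type polynomial term, record §4 R2, meets the hypothesis `hq` of `T4GoodClassBudget.summable_polyRate_logWindow`).
[folklore] -/
theorem polyExponent_of_kappa {C Λ : ℝ} {κ₀ : ℕ} (hκ : 2 * ⌈C * Real.log Λ⌉₊ + 8 ≤ κ₀) :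
    ((⌈C * Real.log Λ⌉₊ : ℕ) : ℝ) + 3 ≤ (κ₀ : ℝ) / 2 - 1 := by
  have h : (((2 * ⌈C * Real.log Λ⌉₊ + 8 : ℕ) : ℝ)) ≤ (κ₀ : ℝ) := by exact_mod_cast hκ
  push_cast at h
  linarith

/-- … and such a `κ₀` exceeds `4` (the crossover slack `hκ` of `T4Crossover.summable_crossoverDelta`). [folklore] -/
theorem four_lt_kappa {C Λ : ℝ} {κ₀ : ℕ} (hκ : 2 * ⌈C * Real.log Λ⌉₊ + 8 ≤ κ₀) : 4 < κ₀ := by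
  omega

/-- THE R-TYPE POLYNOMIAL TERM IS SUMMABLE FOR SUCH `κ₀`: a per-cube discrepancy `d_K ≤ D·(K+1)^{−(κ₀/2 − 1)}`, trivially
counted on the log window, `Σ_K d_K·windowSum 1 Λ (jlog K) K < ∞` (`summable_polyRate_logWindow` + `polyExponent_of_kappa`).
The exponent `κ₀/2 − 1` is record §4 R2's READING of (2.44)'s mechanism applied to a difference functional — [analysis],
NOT PRINTED; only «κ₀ ≧ 7» is fixed in print ([Balaban1988Convergent] (2.46) p. 263, location only). [folklore] -/
theorem summable_polyRate_of_kappa {Λ C D : ℝ} {κ₀ : ℕ} (hΛ : 1 ≤ Λ) (hC : 0 ≤ C) (hD : 0 ≤ D) {d : ℕ → ℝ}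
    (hd0 : ∀ K, 0 ≤ d K) (hd : ∀ K, d K ≤ D * ((K : ℝ) + 1) ^ (-((κ₀ : ℝ) / 2 - 1)))
    (hκ : 2 * ⌈C * Real.log Λ⌉₊ + 8 ≤ κ₀) :
    Summable fun K => d K * windowSum 1 Λ (jlogOf C K) K :=
  summable_polyRate_logWindow hΛ hC hD hd0 hd (polyExponent_of_kappa hκ)

end Budget

/-! ## §6 The end-to-end constructor of `HybridNE7` from the named producers -/

section Closure

variable {ι : Type*} [DecidableEq ι] {l₀ vol : ℝ} {T : ℕ → Finset ι} {A B Acore Bcore : ℕ → ℝ → ι → ℝ}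
  {Bad : ℕ → ℝ → Finset ι} {Cc Rr CcRec RrRec : ℕ → ℝ → ι → ℝ} {ν u s₂ c₀ r s L : ℕ → ℝ}

/-- **NODE U5 CLOSED FROM THE NAMED PRODUCERS (every analytic input a visible binder; nothing of Bałaban's asserted).**
Weight half (row T4-U5.E-a under I-1′): `0 < r₀ < 1`, `V ≥ 0`, `C·(−log r₀) > 1`, non-negative terms (I-2), `SlotDom`
for BOTH runs with the SAME `T`, `Bad` (I-3) and the log-cut budget `V·r₀^{K − jlog_C(K)}`.  Shell half (row
T4-U5.E-c-SHELL°): log-masses `L ≥ 0`, `Σ L < ∞`, flattened bounds `0 ≤ Xcore ≤ X ≤ e^{L_K}·Xcore` for both runs.  Weight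
condition in budget form `V·r₀^{K − jlog(K)} + L_K < 1` (a TAIL condition: arrange it from some `K₀` on and re-index,
`T4MatchingAssembly` §4).  Good-class half (rows T4-U5.E-b / E-c + the new cell NE-R1, interface I-2′): a
`ReindexedBudget` ON THE CORES `Acore`, `Bcore`, with `Summable r, u, s, s₂` (node U4′ through the producers).
Conclusion: `HybridNE7` with `W = 1 − e^{−S}`, shells `X − Xcore`, `Wsh = 1 − e^{−L}`, `δ = (r + u) + (s + s₂)`; then
`HybridNE7.cauchy` gives `MatchingModConstants vol l₀ (hybridDelta vol δ (W + Wsh)) Z`, its summability, the Cauchy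
property and the uniform limit of the generating functions on `|t| ≤ l₀`. [folklore] -/
theorem hybridNE7_closure {r₀ V C : ℝ} (h0 : 0 < r₀) (h1 : r₀ < 1) (hV : 0 ≤ V) (hC : 1 < C * (-Real.log r₀))
    (hA : ∀ K t, |t| ≤ l₀ → ∀ τ ∈ T K, 0 ≤ A K t τ) (hB : ∀ K t, |t| ≤ l₀ → ∀ τ ∈ T K, 0 ≤ B K t τ)
    (hDA : SlotDom l₀ T A Bad fun K => V * r₀ ^ (K - jlogOf C K))
    (hDB : SlotDom l₀ T B Bad fun K => V * r₀ ^ (K - jlogOf C K))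
    (hL0 : ∀ K, 0 ≤ L K) (hLs : Summable L)
    (hA0 : ∀ K t, |t| ≤ l₀ → ∀ τ ∈ T K, 0 ≤ Acore K t τ)
    (hAlo : ∀ K t, |t| ≤ l₀ → ∀ τ ∈ T K, Acore K t τ ≤ A K t τ)
    (hAhi : ∀ K t, |t| ≤ l₀ → ∀ τ ∈ T K, A K t τ ≤ Real.exp (L K) * Acore K t τ)
    (hB0 : ∀ K t, |t| ≤ l₀ → ∀ τ ∈ T K, 0 ≤ Bcore K t τ)
    (hBlo : ∀ K t, |t| ≤ l₀ → ∀ τ ∈ T K, Bcore K t τ ≤ B K t τ)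
    (hBhi : ∀ K t, |t| ≤ l₀ → ∀ τ ∈ T K, B K t τ ≤ Real.exp (L K) * Bcore K t τ)
    (hlt : ∀ K, V * r₀ ^ (K - jlogOf C K) + L K < 1)
    (hTB : ReindexedBudget l₀ vol T Acore Bcore Bad Cc Rr CcRec RrRec ν u s₂ c₀ r s)
    (hr : Summable r) (hu : Summable u) (hs : Summable s) (hs₂ : Summable s₂) :
    HybridNE7 l₀ vol T A B Bad (fun K => 1 - Real.exp (-(V * r₀ ^ (K - jlogOf C K))))
      (fun K t τ => A K t τ - Acore K t τ) (fun K t τ => B K t τ - Bcore K t τ) (fun K => 1 - Real.exp (-L K))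
      (fun K => (r K + u K) + (s K + s₂ K)) :=
  hybridNE7_of_relWeightBound (relWeightBound_of_slotDom_log h0 h1 hV hC hA hB hDA hDB)
    (T4NestedShells.shellWeightBound_of_flattened hL0 hLs hA0 hAlo hAhi hB0 hBlo hBhi)
    (fun K => lt_one_of_budget₂ (hlt K)) (summable_reindexedDelta hr hu hs hs₂)
    (T4NestedShells.hcore_of_cores (goodClause_of_reindexed hTB))

/-- THE SAME WITH A GENERAL WEIGHT HALF AND A GENERAL SHELL BOUND (any producer of `RelWeightBound`: `_of_slotDom_log`,
`_of_slotDom_twoRate_log`, `T4InsertionProfile.relWeightBound_of_pointDom`, `T4PeierlsDomination.relWeightBound_of_posDom`,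
…; any `ShellWeightBound`, e.g. `shellWeightBound_flattened_add`), the good-class half a `ReindexedBudget` on the hybrid
cores `A − shA`, `B − shB`. [folklore] -/
theorem hybridNE7_closure' {shA shB : ℕ → ℝ → ι → ℝ} {W Wsh : ℕ → ℝ} (hW : RelWeightBound l₀ T A B Bad W)
    (hSh : ShellWeightBound l₀ T A B shA shB Wsh) (hlt : ∀ K, W K + Wsh K < 1)
    (hTB : ReindexedBudget l₀ vol T (fun K t τ => A K t τ - shA K t τ) (fun K t τ => B K t τ - shB K t τ) Bad Cc Rr
      CcRec RrRec ν u s₂ c₀ r s)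
    (hr : Summable r) (hu : Summable u) (hs : Summable s) (hs₂ : Summable s₂) :
    HybridNE7 l₀ vol T A B Bad W shA shB Wsh fun K => (r K + u K) + (s K + s₂ K) :=
  hybridNE7_of_goodClause_shell hW hSh hlt (summable_reindexedDelta hr hu hs hs₂) (goodClause_of_reindexed hTB)

end Closure

/-! ## §7 The plug into the scheme: packaging a `HybridNE7` datum with the dictionary -/

section Scheme

open Missing T4Continuum T4Assembly

variable {G : Type*} [GaugeGroup G] [MeasurableSpace G] [HaarData G] {O : Type*}

/-- PACKAGING: a `HybridNE7` datum (e.g. from `hybridNE7_closure`) on an index type in `Type`, together with the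
dictionary identifying the string's dressed partition functions after `K₀ + K` and `K₀ + K + 1` steps with the two runs'
term sums on `|t| ≤ l₀` (nodes E1/E2), IS a `T4MatchingAssembly.StringHybridNE7 S os l₀ vol K₀` — the per-string
hypothesis of `T4MatchingAssembly.matchingModConstants_schemeZ` / `genFunCauchy_of_hybridNE7` /
`hasContinuumLimit_of_hybridNE7`, which then deliver node U5's output, `T4Assembly.GenFunCauchy`, and the node-U0
targets `HasContinuumLimit ∧ HasUniqueLimitPoints ∧ LimitPointsAgree` (positivity discharged by
`T4GenFunBounds.dressedZ_pos`, head free). [folklore] -/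
theorem stringHybridNE7_intro {ι : Type} [DecidableEq ι] {l₀ vol : ℝ} {T : ℕ → Finset ι}
    {A B shA shB : ℕ → ℝ → ι → ℝ} {Bad : ℕ → ℝ → Finset ι} {W Wsh δ : ℕ → ℝ}
    (S : TorusScheme G O) (os : List O) (K₀ : ℕ) (h : HybridNE7 l₀ vol T A B Bad W shA shB Wsh δ)
    (hZA : ∀ K t, |t| ≤ l₀ → T4GenFunBounds.schemeZ S os (K₀ + K) t = ∑ τ ∈ T K, A K t τ)
    (hZB : ∀ K t, |t| ≤ l₀ → T4GenFunBounds.schemeZ S os (K₀ + K + 1) t = ∑ τ ∈ T K, B K t τ) :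
    StringHybridNE7 S os l₀ vol K₀ :=
  ⟨ι, inferInstance, T, A, B, shA, shB, Bad, W, Wsh, δ, h, hZA, hZB⟩

end Scheme

/-! ## §8 Sanity: the re-indexed budget is inhabited -/

section Sanity

/-- SANITY (non-vacuity of `ReindexedBudget`): one class, equal unit weights, no bad class, all constants and radii zero
— the shape holds with `ν = u = s₂ = c₀ = r = s = 0`; `termBudget_of_reindexed` / `goodClause_of_reindexed` then give
the good clause with `δ = 0`.  Shows only that the clauses are jointly satisfiable. [folklore] -/
theorem reindexedBudget_trivial (l₀ vol : ℝ) :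
    ReindexedBudget l₀ vol (fun _ => ({()} : Finset Unit)) (fun _ _ _ => 1) (fun _ _ _ => 1) (fun _ _ => ∅)
      (fun _ _ _ => 0) (fun _ _ _ => 0) (fun _ _ _ => 0) (fun _ _ _ => 0) (fun _ => 0) (fun _ => 0) (fun _ => 0)
      (fun _ => 0) (fun _ => 0) (fun _ => 0) where
  nonneg _ _ _ _ _ := zero_le_one
  lower _ _ _ _ _ := by simp
  upper _ _ _ _ _ := by simp
  uv_const _ _ _ _ _ := by simp
  uv_radius _ _ _ _ _ := by simp
  recent_remainder _ _ _ _ _ := by simp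
  recent_deviation _ _ _ _ _ := by simp

end Sanity

/-! ## §9 The tail: the weight condition is automatic (summable budgets tend to zero; v1.2, append-only) -/

section Tail

variable {ι : Type*} [DecidableEq ι] {l₀ vol : ℝ} {T : ℕ → Finset ι} {A B Acore Bcore : ℕ → ℝ → ι → ℝ}
  {Bad : ℕ → ℝ → Finset ι} {Cc Rr CcRec RrRec : ℕ → ℝ → ι → ℝ} {ν u s₂ c₀ r s L S : ℕ → ℝ}

/-- Two SUMMABLE budgets have `S K + L K < 1` from some `K₀` on (a summable sequence tends to `0`): the weight condition
`W + Wsh < 1` of `HybridNE7` in budget form is a TAIL property that costs nothing. [folklore] -/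
theorem eventually_budget_lt_one (hS : Summable S) (hL : Summable L) : ∃ K₀, ∀ K, K₀ ≤ K → S K + L K < 1 := by
  have h : Tendsto (fun K => S K + L K) atTop (𝓝 0) := (hS.add hL).tendsto_atTop_zero
  have h1 : ∀ᶠ K in atTop, S K + L K < 1 := h.eventually (gt_mem_nhds one_pos)
  obtain ⟨K₀, hK₀⟩ := eventually_atTop.mp h1
  exact ⟨K₀, hK₀⟩

/-- `SlotDom` is stable under the index shift `K ↦ K₀ + K` (every clause is per `K`). [folklore] -/
theorem slotDom_shift (K₀ : ℕ) (h : SlotDom l₀ T A Bad S) :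
    SlotDom l₀ (fun K => T (K₀ + K)) (fun K => A (K₀ + K)) (fun K => Bad (K₀ + K)) fun K => S (K₀ + K) where
  dom K t ht := h.dom (K₀ + K) t ht

/-- `ReindexedBudget` is stable under the index shift `K ↦ K₀ + K`. [folklore] -/
theorem reindexedBudget_shift (K₀ : ℕ) (h : ReindexedBudget l₀ vol T A B Bad Cc Rr CcRec RrRec ν u s₂ c₀ r s) :
    ReindexedBudget l₀ vol (fun K => T (K₀ + K)) (fun K => A (K₀ + K)) (fun K => B (K₀ + K)) (fun K => Bad (K₀ + K))
      (fun K => Cc (K₀ + K)) (fun K => Rr (K₀ + K)) (fun K => CcRec (K₀ + K)) (fun K => RrRec (K₀ + K))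
      (fun K => ν (K₀ + K)) (fun K => u (K₀ + K)) (fun K => s₂ (K₀ + K)) (fun K => c₀ (K₀ + K)) (fun K => r (K₀ + K))
      fun K => s (K₀ + K) where
  nonneg K := h.nonneg (K₀ + K)
  lower K := h.lower (K₀ + K)
  upper K := h.upper (K₀ + K)
  uv_const K := h.uv_const (K₀ + K)
  uv_radius K := h.uv_radius (K₀ + K)
  recent_remainder K := h.recent_remainder (K₀ + K)
  recent_deviation K := h.recent_deviation (K₀ + K)

/-- **THE CLOSURE WITHOUT THE WEIGHT CONDITION** (`hybridNE7_closure` minus the binder `hlt`): since the log-cut slot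
budget `V·r₀^{K − jlog(K)}` (`T4GoodClassBudget.summable_weightMajorant_log`) and the shell log-masses `L` are both
summable, `S_K + L_K < 1` holds from some `K₀` on (`eventually_budget_lt_one`), and every other hypothesis is stable
under the shift `K ↦ K₀ + K`; hence the `K₀`-SHIFTED families carry a `HybridNE7` datum.  The head `K < K₀` needs no
comparison of runs (`T4MatchingAssembly` §4: `matchingModConstants_of_tail`, or the scheme's own `K₀` below).
[folklore] -/
theorem hybridNE7_closure_tail {r₀ V C : ℝ} (h0 : 0 < r₀) (h1 : r₀ < 1) (hV : 0 ≤ V) (hC : 1 < C * (-Real.log r₀))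
    (hA : ∀ K t, |t| ≤ l₀ → ∀ τ ∈ T K, 0 ≤ A K t τ) (hB : ∀ K t, |t| ≤ l₀ → ∀ τ ∈ T K, 0 ≤ B K t τ)
    (hDA : SlotDom l₀ T A Bad fun K => V * r₀ ^ (K - jlogOf C K))
    (hDB : SlotDom l₀ T B Bad fun K => V * r₀ ^ (K - jlogOf C K))
    (hL0 : ∀ K, 0 ≤ L K) (hLs : Summable L)
    (hA0 : ∀ K t, |t| ≤ l₀ → ∀ τ ∈ T K, 0 ≤ Acore K t τ)
    (hAlo : ∀ K t, |t| ≤ l₀ → ∀ τ ∈ T K, Acore K t τ ≤ A K t τ)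
    (hAhi : ∀ K t, |t| ≤ l₀ → ∀ τ ∈ T K, A K t τ ≤ Real.exp (L K) * Acore K t τ)
    (hB0 : ∀ K t, |t| ≤ l₀ → ∀ τ ∈ T K, 0 ≤ Bcore K t τ)
    (hBlo : ∀ K t, |t| ≤ l₀ → ∀ τ ∈ T K, Bcore K t τ ≤ B K t τ)
    (hBhi : ∀ K t, |t| ≤ l₀ → ∀ τ ∈ T K, B K t τ ≤ Real.exp (L K) * Bcore K t τ)
    (hTB : ReindexedBudget l₀ vol T Acore Bcore Bad Cc Rr CcRec RrRec ν u s₂ c₀ r s)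
    (hr : Summable r) (hu : Summable u) (hs : Summable s) (hs₂ : Summable s₂) :
    ∃ K₀, HybridNE7 l₀ vol (fun K => T (K₀ + K)) (fun K => A (K₀ + K)) (fun K => B (K₀ + K)) (fun K => Bad (K₀ + K))
      (fun K => 1 - Real.exp (-(V * r₀ ^ (K₀ + K - jlogOf C (K₀ + K)))))
      (fun K t τ => A (K₀ + K) t τ - Acore (K₀ + K) t τ) (fun K t τ => B (K₀ + K) t τ - Bcore (K₀ + K) t τ)
      (fun K => 1 - Real.exp (-L (K₀ + K)))
      (fun K => (r (K₀ + K) + u (K₀ + K)) + (s (K₀ + K) + s₂ (K₀ + K))) := by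
  have hSum := summable_weightMajorant_log (C := C) h0 h1 hV hC
  obtain ⟨K₀, hK₀⟩ := eventually_budget_lt_one hSum hLs
  have hSum' : Summable fun K => V * r₀ ^ (K₀ + K - jlogOf C (K₀ + K)) := hSum.comp_injective (add_right_injective K₀)
  have hLs' : Summable fun K => L (K₀ + K) := hLs.comp_injective (add_right_injective K₀)
  have hδ' : Summable fun K => (r (K₀ + K) + u (K₀ + K)) + (s (K₀ + K) + s₂ (K₀ + K)) :=
    (summable_reindexedDelta hr hu hs hs₂).comp_injective (add_right_injective K₀)
  refine ⟨K₀, hybridNE7_of_relWeightBound ?_ ?_ (fun K => lt_one_of_budget₂ (hK₀ (K₀ + K) (Nat.le_add_right K₀ K)))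
    hδ' (T4NestedShells.hcore_of_cores (goodClause_of_reindexed (reindexedBudget_shift K₀ hTB)))⟩
  · exact relWeightBound_of_slotDom (fun K => logBudget_nonneg C h0.le hV (K₀ + K)) hSum' (fun K => hA (K₀ + K))
      (fun K => hB (K₀ + K)) (slotDom_shift K₀ hDA) (slotDom_shift K₀ hDB)
  · exact T4NestedShells.shellWeightBound_of_flattened (fun K => hL0 (K₀ + K)) hLs' (fun K => hA0 (K₀ + K))
      (fun K => hAlo (K₀ + K)) (fun K => hAhi (K₀ + K)) (fun K => hB0 (K₀ + K)) (fun K => hBlo (K₀ + K))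
      (fun K => hBhi (K₀ + K))

end Tail

section SchemeTail

open Missing T4Continuum T4Assembly

variable {G : Type*} [GaugeGroup G] [MeasurableSpace G] [HaarData G] {O : Type*}

/-- PACKAGING A SHIFTED DATUM: the E1/E2 dictionary from `K₀` steps on and a `HybridNE7` datum for the `K₁`-shifted
families give `StringHybridNE7 S os l₀ vol (K₀ + K₁)` (re-association of the step count only). [folklore] -/
theorem stringHybridNE7_of_shift {ι : Type} [DecidableEq ι] {l₀ vol : ℝ} {T : ℕ → Finset ι}
    {A B shA shB : ℕ → ℝ → ι → ℝ} {Bad : ℕ → ℝ → Finset ι} {W Wsh δ : ℕ → ℝ}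
    (S : TorusScheme G O) (os : List O) (K₀ K₁ : ℕ)
    (h : HybridNE7 l₀ vol (fun K => T (K₁ + K)) (fun K => A (K₁ + K)) (fun K => B (K₁ + K)) (fun K => Bad (K₁ + K))
      W shA shB Wsh δ)
    (hZA : ∀ K t, |t| ≤ l₀ → T4GenFunBounds.schemeZ S os (K₀ + K) t = ∑ τ ∈ T K, A K t τ)
    (hZB : ∀ K t, |t| ≤ l₀ → T4GenFunBounds.schemeZ S os (K₀ + K + 1) t = ∑ τ ∈ T K, B K t τ) :
    StringHybridNE7 S os l₀ vol (K₀ + K₁) := by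
  refine stringHybridNE7_intro S os (K₀ + K₁) h (fun K t ht => ?_) (fun K t ht => ?_)
  · have e : K₀ + K₁ + K = K₀ + (K₁ + K) := add_assoc _ _ _
    rw [e]
    exact hZA (K₁ + K) t ht
  · have e : K₀ + K₁ + K = K₀ + (K₁ + K) := add_assoc _ _ _
    rw [e]
    exact hZB (K₁ + K) t ht

/-- **PER STRING, END TO END, WITHOUT THE WEIGHT CONDITION**: the closure hypotheses of `hybridNE7_closure_tail` for the
two runs' term families read off after `K₀ + K` resp. `K₀ + K + 1` steps (E1/E2 dictionary `hZA`, `hZB`) give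
`∃ K₁, StringHybridNE7 S os l₀ vol (K₀ + K₁)` — literally the per-string hypothesis of
`T4MatchingAssembly.matchingModConstants_schemeZ` / `genFunCauchy_of_hybridNE7` / `hasContinuumLimit_of_hybridNE7`
(`∀ os, ∃ vol K₀, 0 < vol ∧ StringHybridNE7 S os l₀ vol K₀`).  What the node-U0 consumers still ask besides this datum
is STRUCTURAL, not an estimate: `0 < vol`, and the scheme-regularity binders of `genFunCauchy_of_hybridNE7` (`0 ≤ β_K`,
measurable observables with `|obs| ≤ 1`, the sign convention on `l₀`) — remark R2 of XREAD C-pv14-41.  CONDITIONAL on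
the located new estimates NE7b (+ NE7b-rem), NE7c, NE7 good-class half (+ NE2⁺-LF), NE-R1 two-run half, U4′ — none
PRINTED. [folklore] -/
theorem stringHybridNE7_closure (S : TorusScheme G O) (os : List O) (K₀ : ℕ) {ι : Type} [DecidableEq ι]
    {l₀ vol : ℝ} {T : ℕ → Finset ι} {A B Acore Bcore : ℕ → ℝ → ι → ℝ} {Bad : ℕ → ℝ → Finset ι}
    {Cc Rr CcRec RrRec : ℕ → ℝ → ι → ℝ} {ν u s₂ c₀ r s L : ℕ → ℝ} {r₀ V C : ℝ}
    (h0 : 0 < r₀) (h1 : r₀ < 1) (hV : 0 ≤ V) (hC : 1 < C * (-Real.log r₀))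
    (hA : ∀ K t, |t| ≤ l₀ → ∀ τ ∈ T K, 0 ≤ A K t τ) (hB : ∀ K t, |t| ≤ l₀ → ∀ τ ∈ T K, 0 ≤ B K t τ)
    (hDA : SlotDom l₀ T A Bad fun K => V * r₀ ^ (K - jlogOf C K))
    (hDB : SlotDom l₀ T B Bad fun K => V * r₀ ^ (K - jlogOf C K))
    (hL0 : ∀ K, 0 ≤ L K) (hLs : Summable L)
    (hA0 : ∀ K t, |t| ≤ l₀ → ∀ τ ∈ T K, 0 ≤ Acore K t τ)
    (hAlo : ∀ K t, |t| ≤ l₀ → ∀ τ ∈ T K, Acore K t τ ≤ A K t τ)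
    (hAhi : ∀ K t, |t| ≤ l₀ → ∀ τ ∈ T K, A K t τ ≤ Real.exp (L K) * Acore K t τ)
    (hB0 : ∀ K t, |t| ≤ l₀ → ∀ τ ∈ T K, 0 ≤ Bcore K t τ)
    (hBlo : ∀ K t, |t| ≤ l₀ → ∀ τ ∈ T K, Bcore K t τ ≤ B K t τ)
    (hBhi : ∀ K t, |t| ≤ l₀ → ∀ τ ∈ T K, B K t τ ≤ Real.exp (L K) * Bcore K t τ)
    (hTB : ReindexedBudget l₀ vol T Acore Bcore Bad Cc Rr CcRec RrRec ν u s₂ c₀ r s)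
    (hr : Summable r) (hu : Summable u) (hs : Summable s) (hs₂ : Summable s₂)
    (hZA : ∀ K t, |t| ≤ l₀ → T4GenFunBounds.schemeZ S os (K₀ + K) t = ∑ τ ∈ T K, A K t τ)
    (hZB : ∀ K t, |t| ≤ l₀ → T4GenFunBounds.schemeZ S os (K₀ + K + 1) t = ∑ τ ∈ T K, B K t τ) :
    ∃ K₁, StringHybridNE7 S os l₀ vol (K₀ + K₁) := by
  obtain ⟨K₁, h⟩ := hybridNE7_closure_tail (vol := vol) h0 h1 hV hC hA hB hDA hDB hL0 hLs hA0 hAlo hAhi hB0 hBlo hBhi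
    hTB hr hu hs hs₂
  exact ⟨K₁, stringHybridNE7_of_shift S os K₀ K₁ h hZA hZB⟩

end SchemeTail

end Literature.MathematicalPhysics.QuantumFieldTheory.Balaban1983to89.T4MatchingClosure
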